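import Summits.AtomisticToContinuum.Crystallization.Theses.ReggeStarCoercivity

/-!
# Tightness of the tilted strut well (line `prestress-split-korn`, stub S1 `stub_tiltedWells`, clause (a))

Clause (a) of `TiltedWells` (crux workfile `Cruxes/DefectFreeCrystallizes/Lines/prestress-split-korn.lean`)
asserts `(59/20)(r − r⋆)² ≤ Ṽ(r) − Ṽ(r⋆)` for `r⋆ ∈ [24/25, 49/50]`, `r ∈ [9/10, 21/20]`, where
`Ṽ(r) = V_LJ(r) − ω(r⋆) r²`, `ω(r⋆) = (r⋆⁻⁷ − r⋆⁻¹³)/(2 r⋆)`. The minimum of the ratio sits at the corner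
`(r, r⋆) = (21/20, 49/50)` where it equals `3.0092…`; so the clause is true with a 2.0 % margin and the
constant cannot be raised to `301/100`. Recorded for the line's budget `|ω₁|·K + τ < c′` (refuter, drefute).
-/

namespace Summit.AtomisticToContinuum.Crystallization.Theorems.DefectFreeCrystallizes.Negative.TiltedWellsTight

open Literature.MathematicalPhysics.StatisticalMechanics

/-- At the corner `(r, r⋆) = (21/20, 49/50)` the tilted-well gain is below `(301/100)(r − r⋆)²`
(exact rational evaluation; numerically the ratio is `3.0092`). [folklore] -/
theorem tiltedWell_corner_lt :
    lennardJones (21 / 20) - lennardJones (49 / 50)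
        - ((49 / 50 : ℝ)⁻¹ ^ 7 - (49 / 50 : ℝ)⁻¹ ^ 13) / (2 * (49 / 50)) * ((21 / 20 : ℝ) ^ 2 - (49 / 50) ^ 2)
      < (301 / 100 : ℝ) * (21 / 20 - 49 / 50) ^ 2 := by
  unfold lennardJones; norm_num

/-- … and above `3 (r − r⋆)²` there (so the true minimum ratio lies in `(3, 3.01)`). [folklore] -/
theorem tiltedWell_corner_gt :
    (3 : ℝ) * (21 / 20 - 49 / 50) ^ 2 <
      lennardJones (21 / 20) - lennardJones (49 / 50)
        - ((49 / 50 : ℝ)⁻¹ ^ 7 - (49 / 50 : ℝ)⁻¹ ^ 13) / (2 * (49 / 50)) * ((21 / 20 : ℝ) ^ 2 - (49 / 50) ^ 2) := by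
  unfold lennardJones; norm_num

/-- **Tightness of S1(a)**: the strengthening of clause (a) of `TiltedWells` with constant `301/100` in place
of `59/20` is FALSE (witness the corner `r⋆ = 49/50`, `r = 21/20`). [folklore] -/
theorem not_tiltedWells_a_301 :
    ¬ (∀ rs r : ℝ, 24 / 25 ≤ rs → rs ≤ 49 / 50 → 9 / 10 ≤ r → r ≤ 21 / 20 →
        (301 / 100 : ℝ) * (r - rs) ^ 2 ≤
          lennardJones r - lennardJones rs - (rs⁻¹ ^ 7 - rs⁻¹ ^ 13) / (2 * rs) * (r ^ 2 - rs ^ 2)) := by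
  intro h
  have h1 := h (49 / 50) (21 / 20) (by norm_num) (by norm_num) (by norm_num) (by norm_num)
  exact absurd (lt_of_le_of_lt h1 tiltedWell_corner_lt) (lt_irrefl _)

/-- Likewise clause (b) is tight at its corner `(r, r⋆) = (6/5, 1)`: the gain there is `< (93/100)(r − r⋆)²`
(ratio `0.9216`), so `7/8` cannot be raised to `93/100`. [folklore] -/
theorem not_tiltedWells_b_093 :
    ¬ (∀ rs r : ℝ, 19 / 20 ≤ rs → rs ≤ 1 → 4 / 5 ≤ r → r ≤ 6 / 5 →
        (93 / 100 : ℝ) * (r - rs) ^ 2 ≤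
          lennardJones r - lennardJones rs - (rs⁻¹ ^ 7 - rs⁻¹ ^ 13) / (2 * rs) * (r ^ 2 - rs ^ 2)) := by
  intro h
  have h1 := h 1 (6 / 5) (by norm_num) (by norm_num) (by norm_num) (by norm_num)
  unfold lennardJones at h1
  norm_num at h1

end Summit.AtomisticToContinuum.Crystallization.Theorems.DefectFreeCrystallizes.Negative.TiltedWellsTight
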